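import Summits.ABC.ABC.Theorems.IUTThetaPilotThetaPartIIULineSzpiroBad
import Summits.ABC.ABC.Theorems.IUTThetaPilotABCOfCor312UnionAbove
import HarnessLib

/-!
# Crux `ThetaPartII` (stmt-ABC-19678, route `IUTThetaPilot`), (U) line after RESHAPE-4 «SZPIRO-BAD CUT»: the capstone over the
# TWO REGISTERED (U)-stubs `stub_cor312Bad` ∧ `stub_hullRegimeAboveBad` (skeleton of record sha16 3177a83aca8d622d)

Proof-only helper of the abc-iut cell (seat abc-iut-c312-8 gen 8, layer-2 skeleton holder; route owner's GO: abc-iut-plan g9 RULING C-R32 (1),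
2026-08-26T14:59:51Z). TAKES NO SIDE on [IUTchIII] Cor. 3.12 or on the (U)/(P) readings. Mochizuki, *Inter-universal Teichmüller theory IV*
(RIMS manuscript Apr. 2020 = PRIMS **57** (2021)) Thm. 1.10 (pp. 22–31), Cor. 2.2 (ii) (pp. 41–48); [IUTchIII] Cor. 3.12 (kurims p. 174).

RESHAPE-4 registers, on the (U) line, the RESHAPE-3 stub bodies with abc-iut-c312-d1's SZPIRO-BAD antecedent
(`Cor22.forall_cor312Of_of_szpiroBad`, p449008: `(l+5)/4 < d_mod ∨ (6l(l+5−4d_mod)/((l+4)(l−3)))·(log-diff + (1−1/l)·log 𝔣^{∤2l}) +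
(6l(l+5)/((l+4)(l−3)))·log π < log q^{∤{2,l}}(λ)`) inserted after `CondP6`: `stub_cor312Bad` (= abc-iut-s2-p2's binder `h312Bad` verbatim) and
`stub_hullRegimeAboveBad` (= abc-iut-S3's `habove` with the guard: `2 ≤ d_mod`, abc-iut-c312-d1's slack threshold p427545, non-slot-constant data).
abc-iut-s2-p2's LANDED tail `ThetaPartII_of_cor312Bad_of_hullRegimeBad` (p452755, this directory `…ULineSzpiroBad`) consumes `h312Bad` and the
UNGUARDED-IN-`d_mod` binder `hregBad`; this file supplies the one missing glue and the capstone over the registered pair: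

* `hullRegimeBad_of_hullRegimeAboveBad` — `hregBad` from the registered `stub_hullRegimeAboveBad`, pointwise at `(P, l)` by abc-iut-S3's
  `hullRegime_of_hullRegimeAbove` (below the threshold abc-iut-c312-d1's `PointDict.hullEstimateOf_BIII_of_logQAvoid_le`; at `d_mod = 1` vacuity);
* **`ThetaPartII_of_cor312Bad_of_hullRegimeAboveBad`** / **`ABC_of_cor312Bad_of_hullRegimeAboveBad`** — the crux, and `ABC`, from EXACTLY the two
  registered (U)-stub bodies of skeleton 3177a83aca8d622d (binders `h312Bad`, `haboveBad` byte-identical with the registered signatures);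
* `hullRegimeAboveBad_of_hullRegimeAbove` — the RESHAPE-4 binder is WEAKER than the RESHAPE-3 one (premise drop; for the Corollary binder this is
  abc-iut-s2-p2's `cor312Bad_of_cor312`), so every closer of a RESHAPE-3 stub closes its RESHAPE-4 twin, and abc-iut-S3's landed
  `ABC_of_cor312_of_hullRegimeAbove h312 habove` is (same type, not restated here)
  `ABC_of_cor312Bad_of_hullRegimeAboveBad (cor312Bad_of_cor312 h312) (hullRegimeAboveBad_of_hullRegimeAbove habove)`.

READING (for the planners; numbers, not a side). Kernel refutations of the UNGUARDED binders `hvol`/`hreg` are in the tree (abc-iut-s2-p5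
`Conditional.not_hvol_v3` / `not_hreg_v4`, p453135: the admissible `d_mod = 2` family `P_k = (ℚ(√2), 1/2 + 2/(3+√2)^k)` with the mixed prime `7`);
the RESHAPE-3 `habove` is their announced next target. At that family `log q^{∤2l}(λ_k) ≈ 3k·log 7` while `log 𝔣^{∤2l}(λ_k) ≈ k·log 7` for generic `k`
(zeros of `λ_k`, `1 − λ_k` at the primes of `(3+√2)^k ± 4`), so the Szpiro-bad guard (ratio `> 6l/(l+4)`) FAILS there unless a radical collapse of
abc-quality `≳ 2` occurs at that `k`: the guarded binders of this file are then satisfied VACUOUSLY at `P_k`, not refuted (plan RULING C-R32 caveat).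
HONEST FRAMING: route-level plumbing; CONDITIONAL theorems; nothing asserted about [IUTchIII] Cor. 3.12, Thm. 1.10, any point or any author;
typed ≠ proved. [cite: Mochizuki2012, IUTchIV Thm. 1.10 p. 22–23, Step (v) p. 27–28, Step (viii) p. 30; Cor. 2.2 (ii) p. 46]
[cite: Mochizuki2012, IUTchIII Cor. 3.12 p. 174] [claim: Mochizuki2012, status: disputed] for every IUT quotation.
-/

set_option linter.dupNamespace false

noncomputable section

namespace Summit.ABC.ABC.Theorems.ThetaPartII

open Literature.NumberTheory.DiophantineGeometry.GenEll Literature.IUT.LogVolume Literature.IUT.HodgeTheaters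
open Summit.ABC.IUTFork NumberField IsDedekindDomain Literature.NumberTheory.NumberFields

/-- **abc-iut-s2-p2's tail binder `hregBad` from the REGISTERED stub `stub_hullRegimeAboveBad`** (skeleton 3177a83aca8d622d): at a Szpiro-bad
admissible `(P, l)` the guard is passed through and abc-iut-S3's pointwise glue `hullRegime_of_hullRegimeAbove` removes the `2 ≤ d_mod` /
slack-threshold restrictions (below the threshold: abc-iut-c312-d1 `PointDict.hullEstimateOf_BIII_of_logQAvoid_le` p427545; `d_mod = 1`:
`PointStepV.slotConstant_of_dmod_eq_one`). CONDITIONAL; nothing asserted about the hypothesis.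
[cite: Mochizuki2012, IUTchIV Thm. 1.10 proof Step (v) p. 27–28] [claim: Mochizuki2012, status: disputed] -/
theorem hullRegimeBad_of_hullRegimeAboveBad
    (haboveBad :
      ∀ P : NFPoint, P ∈ UP → ∀ l : ℕ, l.Prime → 5 ≤ l →
        Cor22.AdmitsCore P → Cor22.CondP2 P l → Cor22.CondP5 P l → Cor22.CondP6 P l →
        (((l : ℝ) + 5) / 4 < (Cor22.dmod P : ℝ) ∨
          6 * l * (((l : ℝ) + 5) - 4 * Cor22.dmod P) / (((l : ℝ) + 4) * ((l : ℝ) - 3))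
              * (P.logDiff + (1 - 1 / (l : ℝ)) * Cor22.logCondAvoid P {2, l})
            + 6 * l * ((l : ℝ) + 5) / (((l : ℝ) + 4) * ((l : ℝ) - 3)) * Real.log Real.pi < Cor22.logQAvoid P {2, l}) →
        2 ≤ Cor22.dmod P →
        40 * Real.log (((2 ^ 12 * 3 ^ 3 * 5 * Cor22.dmod P : ℕ) : ℝ) * l)
          * ((Nat.primeCounting (2 ^ 12 * 3 ^ 3 * 5 * Cor22.dmod P * l) : ℝ)
            - (2 * (Cor22.dmod P : ℝ) * (P.logDiff + Cor22.logCondAvoid P {2, l}) + Real.log (2 * 3 * 5 * (l : ℝ)))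
              / Real.log 2) < Cor22.logQAvoid P {2, l} →
        ∀ T : Cor22.ThetaVolumeDatumAt P l,
          (letI := T.instFieldF; letI := T.instNumberFieldF; letI := T.instAlgebraF; letI := T.instFieldK
           letI := T.instNumberFieldK; letI := T.instAlgebraK; letI := T.instFieldFbar; letI := T.instAlgebraFbar
           letI := T.instAlgebraKFbar; letI := T.instIsElliptic
           ¬ (∀ p ∈ T.I.supportPrimes, ∀ v w : placesOver (fieldOfModuli T.E) p,
              (Summit.ABC.IUTFork.DHData.ofInput T.I).logQloc p v = (Summit.ABC.IUTFork.DHData.ofInput T.I).logQloc p w)) →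
          T.HullEstimateOf
            (((l : ℝ) + 1) / 4 *
              ((1 + 12 * (Cor22.dmod P : ℝ) / l) * (P.logDiff + Cor22.logCondAvoid P {2, l})
                + 2 * Real.log l + 52
                + 20 / 3 * Real.log (((2 ^ 12 * 3 ^ 3 * 5 * Cor22.dmod P : ℕ) : ℝ) * (l : ℝ))
                  * (Nat.primeCounting (2 ^ 12 * 3 ^ 3 * 5 * Cor22.dmod P * l) : ℝ)))) :
    ∀ P : NFPoint, P ∈ UP → ∀ l : ℕ, l.Prime → 5 ≤ l →
      Cor22.AdmitsCore P → Cor22.CondP2 P l → Cor22.CondP5 P l → Cor22.CondP6 P l →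
      (((l : ℝ) + 5) / 4 < (Cor22.dmod P : ℝ) ∨
        6 * l * (((l : ℝ) + 5) - 4 * Cor22.dmod P) / (((l : ℝ) + 4) * ((l : ℝ) - 3))
            * (P.logDiff + (1 - 1 / (l : ℝ)) * Cor22.logCondAvoid P {2, l})
          + 6 * l * ((l : ℝ) + 5) / (((l : ℝ) + 4) * ((l : ℝ) - 3)) * Real.log Real.pi < Cor22.logQAvoid P {2, l}) →
      ∀ T : Cor22.ThetaVolumeDatumAt P l,
        (letI := T.instFieldF; letI := T.instNumberFieldF; letI := T.instAlgebraF; letI := T.instFieldK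
         letI := T.instNumberFieldK; letI := T.instAlgebraK; letI := T.instFieldFbar; letI := T.instAlgebraFbar
         letI := T.instAlgebraKFbar; letI := T.instIsElliptic
         ¬ (∀ p ∈ T.I.supportPrimes, ∀ v w : placesOver (fieldOfModuli T.E) p,
            (Summit.ABC.IUTFork.DHData.ofInput T.I).logQloc p v = (Summit.ABC.IUTFork.DHData.ofInput T.I).logQloc p w)) →
        T.HullEstimateOf
          (((l : ℝ) + 1) / 4 *
            ((1 + 12 * (Cor22.dmod P : ℝ) / l) * (P.logDiff + Cor22.logCondAvoid P {2, l})
              + 2 * Real.log l + 52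
              + 20 / 3 * Real.log (((2 ^ 12 * 3 ^ 3 * 5 * Cor22.dmod P : ℕ) : ℝ) * (l : ℝ))
                * (Nat.primeCounting (2 ^ 12 * 3 ^ 3 * 5 * Cor22.dmod P * l) : ℝ))) :=
  fun P hP l hl h5 hcore h2 hP5 h6 hbad =>
    hullRegime_of_hullRegimeAbove hP hl h5 h6 (haboveBad P hP l hl h5 hcore h2 hP5 h6 hbad)

/-- **The crux `ThetaPartII` from EXACTLY the two registered (U)-stubs of RESHAPE-4** (`stub_cor312Bad` = `h312Bad`, `stub_hullRegimeAboveBad` =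
`haboveBad`, bodies byte-identical with skeleton 3177a83aca8d622d): abc-iut-s2-p2's tail `ThetaPartII_of_cor312Bad_of_hullRegimeBad` (p452755;
Szpiro-good points content-free, Szpiro-bad points by the two stubs) after `hullRegimeBad_of_hullRegimeAboveBad`. CONDITIONAL; does not close the
item; nothing asserted about either hypothesis. [cite: Mochizuki2012, IUTchIV Cor. 2.2 (ii) pp. 41–48] [claim: Mochizuki2012, status: disputed] -/
theorem ThetaPartII_of_cor312Bad_of_hullRegimeAboveBad
    (h312Bad :
      ∀ P : NFPoint, P ∈ UP → ∀ l : ℕ, l.Prime → 5 ≤ l →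
        Cor22.AdmitsCore P → Cor22.CondP2 P l → Cor22.CondP5 P l → Cor22.CondP6 P l →
        (((l : ℝ) + 5) / 4 < (Cor22.dmod P : ℝ) ∨
          6 * l * (((l : ℝ) + 5) - 4 * Cor22.dmod P) / (((l : ℝ) + 4) * ((l : ℝ) - 3))
              * (P.logDiff + (1 - 1 / (l : ℝ)) * Cor22.logCondAvoid P {2, l})
            + 6 * l * ((l : ℝ) + 5) / (((l : ℝ) + 4) * ((l : ℝ) - 3)) * Real.log Real.pi < Cor22.logQAvoid P {2, l}) →
          Cor22.Cor312AtDatum P l)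
    (haboveBad :
      ∀ P : NFPoint, P ∈ UP → ∀ l : ℕ, l.Prime → 5 ≤ l →
        Cor22.AdmitsCore P → Cor22.CondP2 P l → Cor22.CondP5 P l → Cor22.CondP6 P l →
        (((l : ℝ) + 5) / 4 < (Cor22.dmod P : ℝ) ∨
          6 * l * (((l : ℝ) + 5) - 4 * Cor22.dmod P) / (((l : ℝ) + 4) * ((l : ℝ) - 3))
              * (P.logDiff + (1 - 1 / (l : ℝ)) * Cor22.logCondAvoid P {2, l})
            + 6 * l * ((l : ℝ) + 5) / (((l : ℝ) + 4) * ((l : ℝ) - 3)) * Real.log Real.pi < Cor22.logQAvoid P {2, l}) →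
        2 ≤ Cor22.dmod P →
        40 * Real.log (((2 ^ 12 * 3 ^ 3 * 5 * Cor22.dmod P : ℕ) : ℝ) * l)
          * ((Nat.primeCounting (2 ^ 12 * 3 ^ 3 * 5 * Cor22.dmod P * l) : ℝ)
            - (2 * (Cor22.dmod P : ℝ) * (P.logDiff + Cor22.logCondAvoid P {2, l}) + Real.log (2 * 3 * 5 * (l : ℝ)))
              / Real.log 2) < Cor22.logQAvoid P {2, l} →
        ∀ T : Cor22.ThetaVolumeDatumAt P l,
          (letI := T.instFieldF; letI := T.instNumberFieldF; letI := T.instAlgebraF; letI := T.instFieldK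
           letI := T.instNumberFieldK; letI := T.instAlgebraK; letI := T.instFieldFbar; letI := T.instAlgebraFbar
           letI := T.instAlgebraKFbar; letI := T.instIsElliptic
           ¬ (∀ p ∈ T.I.supportPrimes, ∀ v w : placesOver (fieldOfModuli T.E) p,
              (Summit.ABC.IUTFork.DHData.ofInput T.I).logQloc p v = (Summit.ABC.IUTFork.DHData.ofInput T.I).logQloc p w)) →
          T.HullEstimateOf
            (((l : ℝ) + 1) / 4 *
              ((1 + 12 * (Cor22.dmod P : ℝ) / l) * (P.logDiff + Cor22.logCondAvoid P {2, l})
                + 2 * Real.log l + 52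
                + 20 / 3 * Real.log (((2 ^ 12 * 3 ^ 3 * 5 * Cor22.dmod P : ℕ) : ℝ) * (l : ℝ))
                  * (Nat.primeCounting (2 ^ 12 * 3 ^ 3 * 5 * Cor22.dmod P * l) : ℝ)))) :
    Summit.ABC.ABC.Theses.IUTThetaPilot.ThetaPartII :=
  ThetaPartII_of_cor312Bad_of_hullRegimeBad h312Bad (hullRegimeBad_of_hullRegimeAboveBad haboveBad)

/-- **`ABC` from EXACTLY the two registered (U)-stubs of RESHAPE-4** — through the route's deciding theorem `closes`, abc-iut-S6's `genEllTwo_holds`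
and the proved `JInvWlog_proof` (as in abc-iut-s2-p2's `ABC_of_cor312Bad_of_hullRegimeBad`). CONDITIONAL; no side taken on [IUTchIII] Cor. 3.12 or on
the (U)/(P) reading. [cite: Mochizuki2012, IUTchIV Cor. 2.2–2.3 pp. 41–55] [cite: Mochizuki2012, IUTchIII Cor. 3.12 p. 174]
[claim: Mochizuki2012, status: disputed] -/
theorem ABC_of_cor312Bad_of_hullRegimeAboveBad
    (h312Bad :
      ∀ P : NFPoint, P ∈ UP → ∀ l : ℕ, l.Prime → 5 ≤ l →
        Cor22.AdmitsCore P → Cor22.CondP2 P l → Cor22.CondP5 P l → Cor22.CondP6 P l →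
        (((l : ℝ) + 5) / 4 < (Cor22.dmod P : ℝ) ∨
          6 * l * (((l : ℝ) + 5) - 4 * Cor22.dmod P) / (((l : ℝ) + 4) * ((l : ℝ) - 3))
              * (P.logDiff + (1 - 1 / (l : ℝ)) * Cor22.logCondAvoid P {2, l})
            + 6 * l * ((l : ℝ) + 5) / (((l : ℝ) + 4) * ((l : ℝ) - 3)) * Real.log Real.pi < Cor22.logQAvoid P {2, l}) →
          Cor22.Cor312AtDatum P l)
    (haboveBad :
      ∀ P : NFPoint, P ∈ UP → ∀ l : ℕ, l.Prime → 5 ≤ l →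
        Cor22.AdmitsCore P → Cor22.CondP2 P l → Cor22.CondP5 P l → Cor22.CondP6 P l →
        (((l : ℝ) + 5) / 4 < (Cor22.dmod P : ℝ) ∨
          6 * l * (((l : ℝ) + 5) - 4 * Cor22.dmod P) / (((l : ℝ) + 4) * ((l : ℝ) - 3))
              * (P.logDiff + (1 - 1 / (l : ℝ)) * Cor22.logCondAvoid P {2, l})
            + 6 * l * ((l : ℝ) + 5) / (((l : ℝ) + 4) * ((l : ℝ) - 3)) * Real.log Real.pi < Cor22.logQAvoid P {2, l}) →
        2 ≤ Cor22.dmod P →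
        40 * Real.log (((2 ^ 12 * 3 ^ 3 * 5 * Cor22.dmod P : ℕ) : ℝ) * l)
          * ((Nat.primeCounting (2 ^ 12 * 3 ^ 3 * 5 * Cor22.dmod P * l) : ℝ)
            - (2 * (Cor22.dmod P : ℝ) * (P.logDiff + Cor22.logCondAvoid P {2, l}) + Real.log (2 * 3 * 5 * (l : ℝ)))
              / Real.log 2) < Cor22.logQAvoid P {2, l} →
        ∀ T : Cor22.ThetaVolumeDatumAt P l,
          (letI := T.instFieldF; letI := T.instNumberFieldF; letI := T.instAlgebraF; letI := T.instFieldK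
           letI := T.instNumberFieldK; letI := T.instAlgebraK; letI := T.instFieldFbar; letI := T.instAlgebraFbar
           letI := T.instAlgebraKFbar; letI := T.instIsElliptic
           ¬ (∀ p ∈ T.I.supportPrimes, ∀ v w : placesOver (fieldOfModuli T.E) p,
              (Summit.ABC.IUTFork.DHData.ofInput T.I).logQloc p v = (Summit.ABC.IUTFork.DHData.ofInput T.I).logQloc p w)) →
          T.HullEstimateOf
            (((l : ℝ) + 1) / 4 *
              ((1 + 12 * (Cor22.dmod P : ℝ) / l) * (P.logDiff + Cor22.logCondAvoid P {2, l})
                + 2 * Real.log l + 52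
                + 20 / 3 * Real.log (((2 ^ 12 * 3 ^ 3 * 5 * Cor22.dmod P : ℕ) : ℝ) * (l : ℝ))
                  * (Nat.primeCounting (2 ^ 12 * 3 ^ 3 * 5 * Cor22.dmod P * l) : ℝ)))) :
    _root_.ABC :=
  ABC_of_cor312Bad_of_hullRegimeBad h312Bad (hullRegimeBad_of_hullRegimeAboveBad haboveBad)

/-! ## A fortiori: the RESHAPE-4 binders are weaker than the RESHAPE-3 ones (premise drop) -/

/-- `stub_hullRegimeAbove` (RESHAPE-3, = abc-iut-S3's `habove`) ⟹ `stub_hullRegimeAboveBad` (RESHAPE-4): ignore the guard. Nothing asserted about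
either. [cite: Mochizuki2012, IUTchIV Thm. 1.10 proof Step (v) p. 27–28] [claim: Mochizuki2012, status: disputed] -/
theorem hullRegimeAboveBad_of_hullRegimeAbove
    (habove :
      ∀ P : NFPoint, P ∈ UP → ∀ l : ℕ, l.Prime → 5 ≤ l →
        Cor22.AdmitsCore P → Cor22.CondP2 P l → Cor22.CondP5 P l → Cor22.CondP6 P l →
        2 ≤ Cor22.dmod P →
        40 * Real.log (((2 ^ 12 * 3 ^ 3 * 5 * Cor22.dmod P : ℕ) : ℝ) * l)
          * ((Nat.primeCounting (2 ^ 12 * 3 ^ 3 * 5 * Cor22.dmod P * l) : ℝ)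
            - (2 * (Cor22.dmod P : ℝ) * (P.logDiff + Cor22.logCondAvoid P {2, l}) + Real.log (2 * 3 * 5 * (l : ℝ)))
              / Real.log 2) < Cor22.logQAvoid P {2, l} →
        ∀ T : Cor22.ThetaVolumeDatumAt P l,
          (letI := T.instFieldF; letI := T.instNumberFieldF; letI := T.instAlgebraF; letI := T.instFieldK
           letI := T.instNumberFieldK; letI := T.instAlgebraK; letI := T.instFieldFbar; letI := T.instAlgebraFbar
           letI := T.instAlgebraKFbar; letI := T.instIsElliptic
           ¬ (∀ p ∈ T.I.supportPrimes, ∀ v w : placesOver (fieldOfModuli T.E) p,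
              (Summit.ABC.IUTFork.DHData.ofInput T.I).logQloc p v = (Summit.ABC.IUTFork.DHData.ofInput T.I).logQloc p w)) →
          T.HullEstimateOf
            (((l : ℝ) + 1) / 4 *
              ((1 + 12 * (Cor22.dmod P : ℝ) / l) * (P.logDiff + Cor22.logCondAvoid P {2, l})
                + 2 * Real.log l + 52
                + 20 / 3 * Real.log (((2 ^ 12 * 3 ^ 3 * 5 * Cor22.dmod P : ℕ) : ℝ) * (l : ℝ))
                  * (Nat.primeCounting (2 ^ 12 * 3 ^ 3 * 5 * Cor22.dmod P * l) : ℝ)))) :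
    ∀ P : NFPoint, P ∈ UP → ∀ l : ℕ, l.Prime → 5 ≤ l →
      Cor22.AdmitsCore P → Cor22.CondP2 P l → Cor22.CondP5 P l → Cor22.CondP6 P l →
      (((l : ℝ) + 5) / 4 < (Cor22.dmod P : ℝ) ∨
        6 * l * (((l : ℝ) + 5) - 4 * Cor22.dmod P) / (((l : ℝ) + 4) * ((l : ℝ) - 3))
            * (P.logDiff + (1 - 1 / (l : ℝ)) * Cor22.logCondAvoid P {2, l})
          + 6 * l * ((l : ℝ) + 5) / (((l : ℝ) + 4) * ((l : ℝ) - 3)) * Real.log Real.pi < Cor22.logQAvoid P {2, l}) →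
      2 ≤ Cor22.dmod P →
      40 * Real.log (((2 ^ 12 * 3 ^ 3 * 5 * Cor22.dmod P : ℕ) : ℝ) * l)
        * ((Nat.primeCounting (2 ^ 12 * 3 ^ 3 * 5 * Cor22.dmod P * l) : ℝ)
          - (2 * (Cor22.dmod P : ℝ) * (P.logDiff + Cor22.logCondAvoid P {2, l}) + Real.log (2 * 3 * 5 * (l : ℝ)))
            / Real.log 2) < Cor22.logQAvoid P {2, l} →
      ∀ T : Cor22.ThetaVolumeDatumAt P l,
        (letI := T.instFieldF; letI := T.instNumberFieldF; letI := T.instAlgebraF; letI := T.instFieldK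
         letI := T.instNumberFieldK; letI := T.instAlgebraK; letI := T.instFieldFbar; letI := T.instAlgebraFbar
         letI := T.instAlgebraKFbar; letI := T.instIsElliptic
         ¬ (∀ p ∈ T.I.supportPrimes, ∀ v w : placesOver (fieldOfModuli T.E) p,
            (Summit.ABC.IUTFork.DHData.ofInput T.I).logQloc p v = (Summit.ABC.IUTFork.DHData.ofInput T.I).logQloc p w)) →
        T.HullEstimateOf
          (((l : ℝ) + 1) / 4 *
            ((1 + 12 * (Cor22.dmod P : ℝ) / l) * (P.logDiff + Cor22.logCondAvoid P {2, l})
              + 2 * Real.log l + 52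
              + 20 / 3 * Real.log (((2 ^ 12 * 3 ^ 3 * 5 * Cor22.dmod P : ℕ) : ℝ) * (l : ℝ))
                * (Nat.primeCounting (2 ^ 12 * 3 ^ 3 * 5 * Cor22.dmod P * l) : ℝ))) :=
  fun P hP l hl h5 hcore h2 hP5 h6 _ => habove P hP l hl h5 hcore h2 hP5 h6

end Summit.ABC.ABC.Theorems.ThetaPartII

end
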